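import Mathlib
import Literature.AlgebraicGeometry.Resolution.TranscendenceDefect
import Literature.AlgebraicGeometry.Resolution.AbhyankarBases
import Literature.AlgebraicGeometry.Resolution.ValuedFunctionFields
import Literature.AlgebraicGeometry.Resolution.ValuedFunctionFieldsLemmas
import Literature.AlgebraicGeometry.Resolution.KnafKuhlmann2009Prop23
import Literature.AlgebraicGeometry.Resolution.NormalizationFractions
import Summits.ResolutionOfSingularities.ResolutionOfSingularities.Theorems.ValuativeLuAlphaPTorsorRankOneAssembly
import Summits.ResolutionOfSingularities.ResolutionOfSingularities.Theorems.ValuativeLuAlphaPTorsorRankOne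
import Summits.ResolutionOfSingularities.ResolutionOfSingularities.Theorems.ValuativeLuAlphaPTorsorPerronMonomializationHelpers
import Summits.ResolutionOfSingularities.ResolutionOfSingularities.Theorems.ValuativeLuAlphaPTorsorAPTorsion
import HarnessLib

/-!
# Quasi-finite generation for rank-one rational Abhyankar valuation rings (`stub_qfgRankOne`)

Crux `SemivaluationShadows` (item `stmt-ResolutionOfSingularities-16757`, route
`ResolutionOfSingularities/AbhyankarShadows`), line `birth`, stub `stub_qfgRankOne`, PROVED twice
over: `qfgRankOne` is the binder form with the skeleton's conclusion `IsQFGModel O R R₁` written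
out, and `stub_qfgRankOne : Sig.stub_qfgRankOne` is the registered signature by name
(`IsQFGModel` and `Sig.stub_qfgRankOne` copied VERBATIM, `private`, from
`Cruxes/SemivaluationShadows/Lines/birth.lean`, which a Theorems file cannot import; both unfold
definitionally to the skeleton's).

**Statement.** Let `k` be algebraically closed of characteristic `p`, `K/k` finitely generated,
`O ∋ k` a valuation ring of `K` which is RATIONAL (every element of `O` is congruent to a constant
modulo `𝔪_O`), ABHYANKAR (`transcendenceDefect k O = 0`) and of RANK ONE (archimedean value group:
`∀ z w, v z < 1 → w ≠ 0 → ∃ N, (v z)^N < v w`). Then every finitely generated `R ⊆ O` is contained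
in a finitely generated `R₁ ⊆ O` with `Frac R₁ = K` whose value semigroup `v(R₁)` (with `v 0 = 0`)
is finitely generated — Teissier's "quasi-finite generation" (Teissier 2014, Thm. 6.21 /
Cor. 6.22) in the rank-one case, equivalently Knaf–Kuhlmann 2005, Thm. 1.1 plus Perron.

**Proof (entirely from the tree).**
1. rational ⇒ zero-dimensional (`f = X - c`);
2. `transcendenceDefect = 0` ⇒ an Abhyankar transcendence basis (`exists_isAbhyankarBasis`,
   Temkin 2013 §2.1) ⇒ the ambient predicate `IsAbhyankarPlace O (im k) ⊤` (Knaf–Kuhlmann 2005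
   §1): `isAbhyankarPlace_top_of_transcendenceDefect_eq_zero`;
3. the very good charts of the `Valuative` route (`PfaffLine.exists_chart_top`, fed with the
   landed chart stubs `stub_henselRootChart`, `stub_perronMonomialization`, `stub_valueStep`,
   `stub_residueStep`) give a finitely generated `R₀ ⊆ O` with `K = Frac R₀` whose centre is
   generated by non-zero `x₁, …, xₙ` of `ℤ`-independent values; `PfaffLine.exists_chart_absorbing`
   enlarges it to such a chart `(A, x')` containing the generators of `R`;
4. on a very good chart every non-zero `a ∈ A` has a dominant monomial
   (`PfaffLine.stub_perronDominantTerm`, Zariski–Perron), so `v a = ∏ v(x'ᵢ)^{μᵢ}` and the value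
   semigroup of `A` is generated by `0` and the `v(x'ᵢ)` (`semigroup_fg_of_chart`).

## Sources

* B. Teissier, *Overweight deformations of affine toric varieties and local uniformization*,
  in: Valuation theory in interaction, EMS 2014, Thm. 6.21 and Cor. 6.22. [Teissier2014]
* H. Knaf, F.-V. Kuhlmann, *Abhyankar places admit local uniformization in any characteristic*,
  Ann. Sci. ÉNS 38 (2005), Thm. 1.1 and Thm. 2.1. [KnafKuhlmann2005]
-/

-- single-problem summit: the doubled namespace component `ResolutionOfSingularities` is forced
set_option linter.dupNamespace false

noncomputable section

open IsLocalRing Literature.AlgebraicGeometry.Resolution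

namespace Summit.ResolutionOfSingularities.ResolutionOfSingularities.Theorems

/-! ## Step 2: `transcendenceDefect = 0` gives an Abhyankar place in the ambient rendering -/

/-- **A valuation ring without transcendence defect is an Abhyankar place of `K/k` (ambient
rendering).** For `K/k` finitely generated and `O ∋ k` a valuation ring of `K` with
`transcendenceDefect k O = 0`, the predicate `IsAbhyankarPlace O (im k) ⊤` holds: an Abhyankar
transcendence basis `x ⊔ y` (`exists_isAbhyankarBasis`: `x` non-zero of `ℤ`-independent values,
`y ⊆ O` with residues a transcendence basis of the residue field, `x ⊔ y` a transcendence basis of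
`K/k`) is a witness — the values of the non-zero constants are `1`, the residue field of `im k`
is the image of `k`, and `K` is algebraic over `k(x, y)`.
[cite: KnafKuhlmann2005, Section 1 (inequality (1)) and Thm. 2.1] -/
theorem isAbhyankarPlace_top_of_transcendenceDefect_eq_zero {k K : Type} [Field k] [Field K]
    [Algebra k K] (hfg : (⊤ : IntermediateField k K).FG) (O : ValuationSubring K)
    (hk : ∀ c : k, algebraMap k K c ∈ O) (hD : transcendenceDefect k O hk = 0) :
    IsAbhyankarPlace O (algebraMap k K).fieldRange ⊤ := by
  classical
  obtain ⟨E, F, x, y, hB⟩ := exists_isAbhyankarBasis O hk hfg hD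
  letI : Algebra k O := algebraOfMem k O hk
  haveI : IsScalarTower k O K := isScalarTower_algebraOfMem k O hk
  set kK : Subfield K := (algebraMap k K).fieldRange with hkK
  have hx0 : ∀ i, x i ≠ 0 := hB.ne_zero
  have hkKO : ∀ z ∈ kK, z ∈ O := by
    intro z hz
    obtain ⟨c, rfl⟩ := RingHom.mem_fieldRange.mp hz
    exact hk c
  refine ⟨E, F, x, fun j => (y j : K), fun j => (y j).2, fun i => ⟨Subfield.mem_top _, hx0 i⟩,
    fun _ => Subfield.mem_top _, ?_, ?_, ?_⟩
  · -- `ℤ`-independence of the values modulo `v(k) = 1`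
    rintro m ⟨b, hb, hm⟩
    have hb0 : b ≠ 0 := by
      rintro rfl
      rw [map_zero] at hm
      exact Finset.prod_ne_zero_iff.mpr
        (fun i _ => zpow_ne_zero _ ((map_ne_zero O.valuation).mpr (hx0 i))) hm
    have hb1 : O.valuation b = 1 := by
      obtain ⟨c, rfl⟩ := RingHom.mem_fieldRange.mp hb
      exact PfaffLine.ap_valuation_algebraMap_eq_one O hk fun hc => hb0 (by rw [hc, map_zero])
    rw [hb1] at hm
    have hli := (linearIndependent_valuation_iff O x hx0).mp hB.linearIndependent Finset.univ m
      (by rw [map_prod]; simp_rw [map_zpow₀]; exact hm)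
    exact funext fun i => hli i (Finset.mem_univ i)
  · -- the residues of `y` are algebraically independent over the residue field of `im k`
    obtain ⟨φ, -, hφs, hφ, -⟩ := exists_residue_ringHoms O kK (F := kK) le_rfl hkKO
    let φ' : k →+* resField O kK := φ.comp (algebraMap k K).rangeRestrictField
    have hφ's : Function.Surjective φ' :=
      hφs.comp (algebraMap k K).rangeRestrictField_bijective.2
    have h := hB.algebraicIndependent_residue.ringHom_of_comp_eq φ' (RingHom.id (ResidueField O))
      hφ's (RingHom.id _).injective ?_
    · simpa using h
    · ext c
      change ((φ ((algebraMap k K).rangeRestrictField c) : ResidueField O)) =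
        residue O ⟨algebraMap k K c, hk c⟩
      rw [hφ]
      rfl
  · -- `K` is algebraic over `k(x, y)`
    have halg := hB.isTranscendenceBasis.isAlgebraic_field
    have hsub : ∀ w : K,
        w ∈ IntermediateField.adjoin k (Set.range (Sum.elim x fun j => (y j : K))) →
        w ∈ IntermediateField.adjoin kK (Set.range x ∪ Set.range fun j => (y j : K)) := by
      intro w hw
      rw [← IntermediateField.mem_toSubfield, IntermediateField.adjoin_toSubfield] at hw ⊢
      refine Subfield.closure_mono ?_ hw
      rw [Set.Sum.elim_range, range_algebraMap_subfield, hkK, RingHom.coe_fieldRange]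
    let incl : IntermediateField.adjoin k (Set.range (Sum.elim x fun j => (y j : K))) →+*
        IntermediateField.adjoin kK (Set.range x ∪ Set.range fun j => (y j : K)) :=
      { toFun := fun w => ⟨w, hsub w w.2⟩
        map_one' := rfl
        map_mul' := fun _ _ => rfl
        map_zero' := rfl
        map_add' := fun _ _ => rfl }
    intro z _
    exact isAlgebraic_of_ringHom_comp_eq incl (RingHom.ext fun _ => rfl) (halg.isAlgebraic z)

/-! ## Step 4: the value semigroup of a very good chart is finitely generated -/

/-- **On a very good chart the value semigroup is finitely generated.** Let `O` be a valuation
ring of `K ⊇ k` with archimedean value group, `R ⊆ O` a `k`-subalgebra whose centre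
`𝔪_O ∩ R` is generated by non-zero `x₁, …, xₙ ∈ R` of `ℤ`-independent values. Then the value
semigroup `v(R)` (a submonoid of the value group with zero, `v 0 = 0` included) is generated by
`0` and `v(x₁), …, v(xₙ)`: every non-zero `a ∈ R` has a dominant monomial
(`PfaffLine.stub_perronDominantTerm`: `a = ∑ c_μ x^μ` with a unit coefficient at `μ₀` whose
monomial strictly dominates), so `v a = ∏ v(xᵢ)^{μ₀ ᵢ}` by the strict ultrametric inequality.
[cite: Teissier2014, Thm. 6.21 / Cor. 6.22] -/
theorem semigroup_fg_of_chart {k K : Type} [Field k] [Field K] [Algebra k K]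
    (O : ValuationSubring K)
    (hr1 : ∀ z w : K, O.valuation z < 1 → w ≠ 0 → ∃ N : ℕ, O.valuation z ^ N < O.valuation w)
    {n : ℕ} (R : Subalgebra k K) (hRO : R.toSubring ≤ O.toSubring) (x : Fin n → K)
    (hx : ∀ i, x i ∈ R) (hx0 : ∀ i, x i ≠ 0)
    (hspan : Ideal.span (Set.range fun i => (⟨x i, hx i⟩ : R.toSubring)) =
      Ideal.comap (Subring.inclusion hRO) (maximalIdeal O))
    (hind : ∀ m : Fin n → ℤ, (∏ i, O.valuation (x i) ^ (m i)) = 1 → m = 0) :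
    (MonoidHom.mrange (O.valuation.toMonoidWithZeroHom.toMonoidHom.comp
        R.val.toRingHom.toMonoidHom)).FG := by
  classical
  set G : Set O.ValueGroup := insert 0 (Set.range fun i => O.valuation (x i)) with hG
  have hGfin : G.Finite := (Set.finite_range _).insert 0
  rw [Submonoid.fg_iff]
  refine ⟨G, le_antisymm (Submonoid.closure_le.mpr ?_) ?_, hGfin⟩
  · -- the generators are values of elements of `R`
    rintro γ (rfl | ⟨i, rfl⟩)
    · exact ⟨⟨0, R.zero_mem⟩, by simp⟩
    · exact ⟨⟨x i, hx i⟩, rfl⟩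
  · -- every value of `R` is a monomial in the `v(xᵢ)` (or `0`)
    rintro γ ⟨⟨a, haR⟩, rfl⟩
    change O.valuation a ∈ Submonoid.closure G
    by_cases ha0 : a = 0
    · rw [ha0, map_zero]
      exact Submonoid.subset_closure (Set.mem_insert 0 _)
    obtain ⟨P, μ₀, hμ₀, hPR, hv1, hdom, hPe⟩ :=
      PfaffLine.stub_perronDominantTerm k K O n R hRO x hx hx0 hspan hind hr1 a haR ha0
    have hvle : ∀ μ, O.valuation (P.coeff μ) ≤ 1 := fun μ =>
      (O.valuation_le_one_iff _).mpr (hRO (hPR μ))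
    have hvmon : ∀ μ : Fin n →₀ ℕ,
        O.valuation (∏ i, x i ^ (μ i)) = ∏ i, O.valuation (x i) ^ (μ i) := fun μ => by
      simp only [map_prod, map_pow]
    have hva : O.valuation a = ∏ i, O.valuation (x i) ^ (μ₀ i) := by
      rw [← hPe, MvPolynomial.eval_eq', O.valuation.map_sum_eq_of_lt hμ₀]
      · rw [map_mul, hv1, one_mul, hvmon]
      · intro μ hμ
        rw [Finset.mem_sdiff, Finset.mem_singleton] at hμ
        rw [map_mul, map_mul, hv1, one_mul, hvmon, hvmon]
        exact lt_of_le_of_lt (mul_le_of_le_one_left' (hvle μ)) (hdom μ hμ.1 hμ.2)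
    rw [hva]
    refine Submonoid.prod_mem _ fun i _ => Submonoid.pow_mem _ (Submonoid.subset_closure ?_) _
    exact Set.mem_insert_of_mem 0 (Set.mem_range_self i)

/-! ## Quasi-finite generation in rank one (binder form) -/

/-- **Quasi-finite generation for RANK-ONE rational Abhyankar valuation rings over an
algebraically closed field** (Teissier 2014, Thm. 6.21 / Cor. 6.22, rank-one case; Knaf–Kuhlmann
2005, Thm. 1.1 + Perron), binder form of the stub `stub_qfgRankOne` below with the skeleton's
`IsQFGModel O R R₁` unfolded. For `k = k̄` of characteristic `p`, `K/k` finitely generated, `O ∋ k`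
a valuation ring of `K` which is rational (`∀ x ∈ O, ∃ c, v(x - c) < 1`), has
`transcendenceDefect k O = 0`, and has archimedean value group, every finitely generated `R ⊆ O`
lies in a finitely generated `R₁ ⊆ O` with `Frac R₁ = K` and finitely generated value semigroup
`v(R₁)`. Proof: rational ⇒ zero-dimensional; `isAbhyankarPlace_top_of_transcendenceDefect_eq_zero`;
a very good chart of `K` (`PfaffLine.exists_chart_top` with the landed chart stubs) absorbing the
generators of `R` (`PfaffLine.exists_chart_absorbing`); `semigroup_fg_of_chart`.
[cite: Teissier2014, Thm. 6.21 / Cor. 6.22] -/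
theorem qfgRankOne (p : ℕ) (hp : p.Prime) (k K : Type) [Field k] [CharP k p] [IsAlgClosed k]
    [Field K] [Algebra k K] (hfg : (⊤ : IntermediateField k K).FG) (O : ValuationSubring K)
    (hk : ∀ c : k, algebraMap k K c ∈ O)
    (hrat : ∀ x : K, x ∈ O → ∃ c : k, O.valuation (x - algebraMap k K c) < 1)
    (hD : Literature.AlgebraicGeometry.Resolution.transcendenceDefect k O hk = 0)
    (hr1 : ∀ z w : K, O.valuation z < 1 → w ≠ 0 → ∃ N : ℕ, O.valuation z ^ N < O.valuation w)
    (R : Subalgebra k K) (hR : R.FG) (hRO : R.toSubring ≤ O.toSubring) :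
    ∃ R₁ : Subalgebra k K, R ≤ R₁ ∧ R₁.toSubring ≤ O.toSubring ∧ R₁.FG ∧ IsFractionRing R₁ K ∧
      (MonoidHom.mrange (O.valuation.toMonoidWithZeroHom.toMonoidHom.comp
        R₁.val.toRingHom.toMonoidHom)).FG := by
  classical
  -- (1) rational ⇒ zero-dimensional
  have hzd : ∀ x : K, x ∈ O → ∃ f : Polynomial k, f ≠ 0 ∧ Polynomial.aeval x f ∈ O.nonunits := by
    intro x hx
    obtain ⟨c, hc⟩ := hrat x hx
    refine ⟨Polynomial.X - Polynomial.C c, Polynomial.X_sub_C_ne_zero c, ?_⟩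
    rw [map_sub, Polynomial.aeval_X, Polynomial.aeval_C, ValuationSubring.mem_nonunits_iff]
    exact hc
  -- (2) an Abhyankar place in the ambient rendering
  have hA : IsAbhyankarPlace O (algebraMap k K).fieldRange ⊤ :=
    isAbhyankarPlace_top_of_transcendenceDefect_eq_zero hfg O hk hD
  -- (3) a very good chart of `K`, absorbing the non-zero generators of `R`
  obtain ⟨s, hs⟩ := hfg
  obtain ⟨n, R₀, hR₀O, x, hx, hR₀fg, hfrac, hx0, hspan, hind, -⟩ :=
    PfaffLine.exists_chart_top PfaffLine.stub_henselRootChart PfaffLine.stub_perronMonomialization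
      PfaffLine.stub_valueStep PfaffLine.stub_residueStep hp O hk hzd hA hr1 s hs
  obtain ⟨g, hg⟩ := hR
  have hgR : ∀ z ∈ g, z ∈ R := fun z hz => by rw [← hg]; exact Algebra.subset_adjoin hz
  set g₁ : Finset K := g.filter fun z => z ≠ 0 with hg₁
  let a : Fin g₁.card → K := fun j => (g₁.equivFin.symm j : K)
  have hag₁ : ∀ j, a j ∈ g₁ := fun j => (g₁.equivFin.symm j).2
  have haO : ∀ j, a j ∈ O := fun j => hRO (hgR _ (Finset.mem_filter.mp (hag₁ j)).1)
  have ha0 : ∀ j, a j ≠ 0 := fun j => (Finset.mem_filter.mp (hag₁ j)).2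
  obtain ⟨A, hAO, x', hx', hR₀A, hAfg, haA, hx'0, hspanA, hindA⟩ :=
    PfaffLine.exists_chart_absorbing PfaffLine.stub_perronMonomialization O hr1 R₀ hR₀O x hx hR₀fg
      hfrac hx0 hspan hind a haO ha0
  have hgA : ∀ z ∈ g, z ∈ A := by
    intro z hz
    by_cases hz0 : z = 0
    · rw [hz0]; exact A.zero_mem
    · have hz₁ : z ∈ g₁ := Finset.mem_filter.mpr ⟨hz, hz0⟩
      have h := haA (g₁.equivFin ⟨z, hz₁⟩)
      simpa [a] using h
  -- (5) `Frac A = K`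
  have hfracA : ∀ z : K, ∃ a' ∈ A.toSubring, ∃ b' ∈ A.toSubring, z = a' / b' := by
    intro z
    have hz : z ∈ Subfield.closure (A : Set K) :=
      Subfield.closure_mono (fun w hw => hR₀A hw) (hfrac z)
    obtain ⟨y, hy, w, hw, rfl⟩ := Subfield.mem_closure_iff.mp hz
    have hcl : Subring.closure (A : Set K) = A.toSubring := Subring.closure_eq A.toSubring
    rw [hcl] at hy hw
    exact ⟨y, hy, w, hw, rfl⟩
  have hfrA : IsFractionRing A K := isFractionRing_of_forall_exists_div A.toSubring hfracA
  -- (4) the semigroup of the absorbing chart is finitely generated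
  refine ⟨A, ?_, hAO, hAfg, hfrA, semigroup_fg_of_chart O hr1 A hAO x' hx' hx'0 hspanA hindA⟩
  rw [← hg, Algebra.adjoin_le_iff]
  exact fun z hz => hgA z hz

/-! ## The registered stub signature, by name

`IsQFGModel` and `Sig.stub_qfgRankOne` are copied VERBATIM from the line skeleton
`Cruxes/SemivaluationShadows/Lines/birth.lean` (v2); they are `private` so that sibling stub files
can do the same without name clashes — the statements unfold definitionally to the skeleton's. -/

/-- VERBATIM copy of the skeleton's `IsQFGModel O R R₁` (a predicate of the line skeleton, not a
named fact): `R₁` is a local blowing up of `R` along `O` (`R ≤ R₁ ⊆ O`, finitely generated,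
`Frac R₁ = K`) on which the value semigroup `ν(R₁)` (with `0 = ν(0)`, as a submonoid of the value
group with zero) is finitely generated. -/
private def IsQFGModel {k K : Type} [Field k] [Field K] [Algebra k K] (O : ValuationSubring K)
    (R R₁ : Subalgebra k K) : Prop :=
  R ≤ R₁ ∧ R₁.toSubring ≤ O.toSubring ∧ R₁.FG ∧ IsFractionRing R₁ K ∧
    (MonoidHom.mrange (O.valuation.toMonoidWithZeroHom.toMonoidHom.comp
      R₁.val.toRingHom.toMonoidHom)).FG

/-- VERBATIM copy of the skeleton's registered signature `Sig.stub_qfgRankOne` (the statement of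
the stub, PROVED below as `stub_qfgRankOne` — not a named fact): over an algebraically closed field
of characteristic `p`, a rational ABHYANKAR valuation ring (`transcendenceDefect = 0`) of a finitely
generated `K/k` whose value group is ARCHIMEDEAN admits a QFG model above every finitely generated
`R ⊆ O`. -/
private def Sig.stub_qfgRankOne : Prop :=
  ∀ p : ℕ, p.Prime → ∀ (k K : Type) [Field k] [CharP k p] [IsAlgClosed k] [Field K] [Algebra k K],
    (⊤ : IntermediateField k K).FG → ∀ (O : ValuationSubring K)
    (hk : ∀ c : k, algebraMap k K c ∈ O),
    (∀ x : K, x ∈ O → ∃ c : k, O.valuation (x - algebraMap k K c) < 1) →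
    transcendenceDefect k O hk = 0 →
    (∀ z w : K, O.valuation z < 1 → w ≠ 0 → ∃ N : ℕ, O.valuation z ^ N < O.valuation w) →
    ∀ R : Subalgebra k K, R.FG → R.toSubring ≤ O.toSubring → ∃ R₁ : Subalgebra k K, IsQFGModel O R R₁

/-- **STUB `stub_qfgRankOne` of line `birth` of crux `SemivaluationShadows`, PROVED** (registered
signature `Sig.stub_qfgRankOne`, by name; it unfolds to the skeleton's statement verbatim):
quasi-finite generation for rank-one rational Abhyankar valuation rings over an algebraically
closed field of characteristic `p` — `qfgRankOne`. [cite: Teissier2014, Thm. 6.21 / Cor. 6.22] -/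
theorem stub_qfgRankOne : Sig.stub_qfgRankOne :=
  fun p hp k K _ _ _ _ _ => qfgRankOne p hp k K

end Summit.ResolutionOfSingularities.ResolutionOfSingularities.Theorems

end
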